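import Summits.PneNP.PneNP.Theses.KarlinRubin
import Literature.Computability.Complexity.CircuitClassesProofs
import Literature.Computability.Complexity.NegationLimitedProofs
import Literature.Computability.Complexity.PseudoComplementCircuits
import Summits.PneNP.PneNP.Theorems.KarlinRubinMonotoneSufficesStubNullMass
import Summits.PneNP.PneNP.Theorems.KarlinRubinMonotoneSufficesStubPlantedMass

/-!
# Crux `MonotoneSuffices` (stmt-PneNP-18026), line `Sketch` (compression) — first rung of the kernel:
negated INPUT VARIABLES are eliminable on the planted pair at size cost `×2` each

Write a detector in De Morgan form with negations on a finite set `T` of input variables: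
`f_T(x) = F(ℓ_T(x))`, where `F` is computed by a `{∧₂,∨₂,0,1}`-circuit on the doubled input `ι ⊕ ι`
and the literal vector is `ℓ_T(x) = (x, (¬x_i)_{i ∈ T} ; 1 elsewhere)`. Compressing `f_T` along `e ∈ T`
(Kleitman down-up compression `S_e f (x) = (f x[e←0] ∧ f x[e←1]) ∨ (x_e ∧ (f x[e←0] ∨ f x[e←1]))`, the
lever of line `Sketch`) gives EXACTLY `f'_{T∖e}` for the monotone circuit
`F'(z) = (F(σ₀ z) ∧ F(σ₁ z)) ∨ (z_{inl e} ∧ (F(σ₀ z) ∨ F(σ₁ z)))`, where `σ_b` hard-wires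
`z_{inl e} := b`, `z_{inr e} := ¬b` (constants are gates of `monotoneBasis01`); `|F'| ≤ 2|F| + 8`
(`negIn_compress_step`). Iterating over `T` costs `2^{|T|}(|F|+8)` gates and, since compression never
increases the error sum on the planted pair (landed stubs `stub_nullMass`, `stub_plantedMass`), yields a
`{∧₂,∨₂,0,1}`-circuit whose error sum is at most that of `f_T` (`negIn_elim`). Consequently
`MonotoneSuffices` HOLDS for De Morgan detector families with `2^{|T n|} ≤ (s n + n)^c` negated
variables, with exponent `a = c + 1` (`stub_negatedInputs`): the first rung of the kernel
`stub_budget` by negation structure. (Worst case, even one negated variable makes a function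
non-monotone, so no simulation statement of this kind exists off a distribution; on the pair the
compressed function is a DIFFERENT, monotone function with no larger error.)
-/

set_option linter.dupNamespace false -- `Summit.PneNP.PneNP.…`: summit = sub-problem name (D-0017)

namespace Summit.PneNP.PneNP.Theorems.MonotoneSuffices.Compression

open Literature.Computability.Complexity Filter Finset
open Literature.Probability.RandomGraphs.PlantedClique
open Function (update)
open scoped ENNReal

/-! ### Gates over `{∧₂, ∨₂, 0, 1}` in the `CktSize` calculus -/

section Gates

variable {ι : Type*}

/-- The sorting combinator `(a ∧ b) ∨ (c ∧ (a ∨ b))` (`= MAJ₃(c, a, b)`) on three given inputs costs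
`4` gates over `{∧₂, ∨₂, 0, 1}`. [folklore] -/
theorem negIn_cktSize_sort (a b c : ι) :
    CktSize monotoneBasis01
      (fun (x : ι → Bool) (_ : Unit) => ((x a && x b) || (x c && (x a || x b)))) 4 := by
  have h1 : CktSize monotoneBasis01 (fun (x : ι → Bool) => Sum.elim x (fun (_ : Unit) => (x a || x b)))
      (0 + 1) := (CktSize.id monotoneBasis01).pair ((cktSize_or_mono a b).basis_mono monotoneBasis_subset_monotoneBasis01)
  have h2 : CktSize monotoneBasis01 (fun (y : ι ⊕ Unit → Bool) =>
      Sum.elim (fun (_ : Unit) => (y (.inl a) && y (.inl b)))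
        (fun (_ : Unit) => (y (.inl c) && y (.inr ())))) (1 + 1) :=
    ((cktSize_and_mono _ _).basis_mono monotoneBasis_subset_monotoneBasis01).pair
      ((cktSize_and_mono _ _).basis_mono monotoneBasis_subset_monotoneBasis01)
  have h3 : CktSize monotoneBasis01
      (fun (z : Unit ⊕ Unit → Bool) (_ : Unit) => (z (.inl ()) || z (.inr ()))) 1 :=
    (cktSize_or_mono _ _).basis_mono monotoneBasis_subset_monotoneBasis01
  exact ((h1.comp h2).comp h3).congr fun x _ => by simp

/-- The hard-wiring map `σ_b : z ↦ z[inl e := b][inr e := ¬b]` on the doubled cube costs two constant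
gates over `{∧₂, ∨₂, 0, 1}`. [folklore] -/
theorem negIn_cktSize_hardwire [DecidableEq ι] (e : ι) (b : Bool) :
    CktSize monotoneBasis01
      (fun (z : ι ⊕ ι → Bool) (w : ι ⊕ ι) => update (update z (Sum.inl e) b) (Sum.inr e) (!b) w) 2 := by
  have h : CktSize monotoneBasis01 (fun (z : ι ⊕ ι → Bool) =>
      Sum.elim (Sum.elim z (fun (_ : Unit) => b)) (fun (_ : Unit) => !b)) ((0 + 1) + 1) :=
    ((CktSize.id monotoneBasis01).pair (cktSize_const_mono01 _ b)).pair (cktSize_const_mono01 _ (!b))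
  refine (h.outMap (fun w : ι ⊕ ι => if w = Sum.inr e then Sum.inr ()
    else if w = Sum.inl e then Sum.inl (Sum.inr ()) else Sum.inl (Sum.inl w))).congr fun z w => ?_
  by_cases h1 : w = Sum.inr e
  · subst h1; simp
  · by_cases h2 : w = Sum.inl e
    · subst h2; simp [h1]
    · simp [h1, h2]

end Gates

/-! ### One compression step on a De Morgan detector with negated inputs on `T` -/

section Step

variable {ι : Type*} [DecidableEq ι]

/-- The literal vector after updating the input at `e ∈ T`: `ℓ_T(x[e←b]) = σ_b(ℓ_{T∖e}(x))`. [folklore] -/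
theorem negIn_litVec_update (T : Finset ι) (e : ι) (he : e ∈ T) (x : ι → Bool) (b : Bool) :
    (Sum.elim (update x e b) (fun i => if i ∈ T then !(update x e b i) else true) : ι ⊕ ι → Bool) =
      update (update (Sum.elim x (fun i => if i ∈ T.erase e then !(x i) else true)) (Sum.inl e) b)
        (Sum.inr e) (!b) := by
  funext w
  rcases w with i | i
  · rw [Sum.elim_inl, Function.update_of_ne Sum.inl_ne_inr]
    by_cases hi : i = e
    · subst hi
      rw [Function.update_self, Function.update_self]
    · rw [Function.update_of_ne hi, Function.update_of_ne (fun h => hi (Sum.inl_injective h)),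
        Sum.elim_inl]
  · rw [Sum.elim_inr]
    by_cases hi : i = e
    · subst hi
      rw [Function.update_self, if_pos he, Function.update_self]
    · rw [Function.update_of_ne (fun h => hi (Sum.inr_injective h)),
        Function.update_of_ne Sum.inr_ne_inl, Sum.elim_inr, Function.update_of_ne hi]
      have hiff : i ∈ T.erase e ↔ i ∈ T := by
        rw [Finset.mem_erase]
        exact ⟨fun h => h.2, fun h => ⟨hi, h⟩⟩
      simp only [hiff]

/-- **One step.** Compressing `x ↦ F(ℓ_T(x))` along `e ∈ T` is computed EXACTLY by a
`{∧₂, ∨₂, 0, 1}`-circuit of size `≤ 2s + 8` applied to `ℓ_{T∖e}(x)`, when `F` has such a circuit of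
size `≤ s`. [folklore] -/
theorem negIn_compress_step (T : Finset ι) (e : ι) (he : e ∈ T) (F : (ι ⊕ ι → Bool) → Bool) (s : ℕ)
    (hF : CktSize monotoneBasis01 (fun z (_ : Unit) => F z) s) :
    ∃ F' : (ι ⊕ ι → Bool) → Bool, CktSize monotoneBasis01 (fun z (_ : Unit) => F' z) (2 * s + 8) ∧
      ∀ x : ι → Bool,
        ((F (Sum.elim (update x e false) (fun i => if i ∈ T then !(update x e false i) else true)) &&
            F (Sum.elim (update x e true) (fun i => if i ∈ T then !(update x e true i) else true))) ||
          (x e &&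
            (F (Sum.elim (update x e false) (fun i => if i ∈ T then !(update x e false i) else true)) ||
              F (Sum.elim (update x e true) (fun i => if i ∈ T then !(update x e true i) else true))))) =
        F' (Sum.elim x (fun i => if i ∈ T.erase e then !(x i) else true)) := by
  -- the two hard-wired copies of `F`
  have hc : ∀ b : Bool, CktSize monotoneBasis01
      (fun (z : ι ⊕ ι → Bool) (_ : Unit) => F (update (update z (Sum.inl e) b) (Sum.inr e) (!b))) (2 + s) :=
    fun b => ((negIn_cktSize_hardwire e b).comp hF).congr fun _ _ => rfl
  -- bundle them with the pass-through of the inputs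
  have hG : CktSize monotoneBasis01 (fun (z : ι ⊕ ι → Bool) =>
      Sum.elim (Sum.elim (fun (_ : Unit) => F (update (update z (Sum.inl e) false) (Sum.inr e) (!false)))
        (fun (_ : Unit) => F (update (update z (Sum.inl e) true) (Sum.inr e) (!true)))) z)
      (((2 + s) + (2 + s)) + 0) := ((hc false).pair (hc true)).pair (CktSize.id monotoneBasis01)
  -- and sort
  have hS := hG.comp (negIn_cktSize_sort (ι := (Unit ⊕ Unit) ⊕ (ι ⊕ ι))
    (Sum.inl (Sum.inl ())) (Sum.inl (Sum.inr ())) (Sum.inr (Sum.inl e)))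
  refine ⟨fun z => ((F (update (update z (Sum.inl e) false) (Sum.inr e) true) &&
      F (update (update z (Sum.inl e) true) (Sum.inr e) false)) ||
        (z (Sum.inl e) && (F (update (update z (Sum.inl e) false) (Sum.inr e) true) ||
          F (update (update z (Sum.inl e) true) (Sum.inr e) false)))),
    (hS.of_le (by omega)).congr fun z _ => by
      simp only [Sum.elim_inl, Sum.elim_inr, Bool.not_false, Bool.not_true], fun x => ?_⟩
  rw [negIn_litVec_update T e he x false, negIn_litVec_update T e he x true]
  simp only [Sum.elim_inl, Bool.not_false, Bool.not_true]

end Step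

/-! ### Iterating over `T` on the planted pair -/

/-- **Elimination of negated inputs on the planted pair.** For every finite set `T` of edge
coordinates and every `F` on the doubled cube with a `{∧₂,∨₂,0,1}`-circuit of size `≤ s`, there is a
Boolean function `G` on `EdgeVec n` with a `{∧₂,∨₂,0,1}`-circuit of size `≤ 2^{|T|}(s + 8)` whose error
sum (type I under `G(n,1/2)` + type II under the planted `k`-clique) is at most that of the De Morgan
detector `x ↦ F(ℓ_T(x))` with negated inputs on `T` — obtained by compressing along the coordinates of
`T` one at a time (`negIn_compress_step`; the error sum never increases by the landed stubs
`stub_nullMass`, `stub_plantedMass`). [folklore] -/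
theorem negIn_elim (n k : ℕ) (T : Finset ((⊤ : SimpleGraph (Fin n)).edgeSet)) :
    ∀ (F : ((⊤ : SimpleGraph (Fin n)).edgeSet ⊕ (⊤ : SimpleGraph (Fin n)).edgeSet → Bool) → Bool) (s : ℕ),
      CktSize monotoneBasis01 (fun z (_ : Unit) => F z) s →
      ∃ G : EdgeVec n → Bool, CktSize monotoneBasis01 (fun x (_ : Unit) => G x) (2 ^ T.card * (s + 8)) ∧
        (erdosRenyiHalf n).toOuterMeasure {x | G x = true} +
            (plantedCliqueDist n k).toOuterMeasure {x | G x = false} ≤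
          (erdosRenyiHalf n).toOuterMeasure
              {x | F (Sum.elim x (fun i => if i ∈ T then !(x i) else true)) = true} +
            (plantedCliqueDist n k).toOuterMeasure
              {x | F (Sum.elim x (fun i => if i ∈ T then !(x i) else true)) = false} := by
  classical
  induction T using Finset.induction_on with
  | empty =>
    intro F s hF
    refine ⟨fun x => F (Sum.elim x (fun i => if i ∈ (∅ : Finset _) then !(x i) else true)), ?_, le_rfl⟩
    -- `x ↦ (x, 1)` costs one constant gate
    have h1 : CktSize monotoneBasis01 (fun (x : EdgeVec n) =>
        Sum.elim x (fun (_ : Unit) => true)) (0 + 1) :=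
      (CktSize.id monotoneBasis01).pair (cktSize_const_mono01 _ true)
    have h2 := (h1.outMap (fun w : (⊤ : SimpleGraph (Fin n)).edgeSet ⊕ (⊤ : SimpleGraph (Fin n)).edgeSet =>
      Sum.elim (fun i => Sum.inl i) (fun _ => Sum.inr ()) w)).comp hF
    refine (h2.of_le (by simp only [Finset.card_empty, pow_zero, one_mul]; omega)).congr fun x _ => ?_
    simp only [Finset.notMem_empty, if_false]
    congr 1
    funext w
    rcases w with i | i
    · rfl
    · rfl
  | insert e T heT ih =>
    intro F s hF
    obtain ⟨F', hF', hstep⟩ := negIn_compress_step (insert e T) e (Finset.mem_insert_self e T) F s hF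
    obtain ⟨G, hG, herr⟩ := ih F' (2 * s + 8) hF'
    refine ⟨G, ?_, herr.trans ?_⟩
    · rw [Finset.card_insert_of_notMem heT, pow_succ]
      exact hG.of_le (le_of_eq (by ring))
    · -- `F' ∘ ℓ_T = S_e (F ∘ ℓ_{insert e T})`, and compression does not increase the error sum
      let f : EdgeVec n → Bool := fun y => F (Sum.elim y (fun i => if i ∈ insert e T then !(y i) else true))
      have key : ∀ x : EdgeVec n,
          ((f (update x e false) && f (update x e true)) ||
              (x e && (f (update x e false) || f (update x e true)))) =
            F' (Sum.elim x (fun i => if i ∈ T then !(x i) else true)) := fun x => by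
        have h := hstep x
        rw [Finset.erase_insert heT] at h
        exact h
      have hset1 : {x : EdgeVec n | F' (Sum.elim x (fun i => if i ∈ T then !(x i) else true)) = true} =
          {x | ((f (update x e false) && f (update x e true)) ||
              (x e && (f (update x e false) || f (update x e true)))) = true} :=
        Set.ext fun x => by simp only [Set.mem_setOf_eq, key x]
      have hset2 : {x : EdgeVec n | F' (Sum.elim x (fun i => if i ∈ T then !(x i) else true)) = false} =
          {x | ((f (update x e false) && f (update x e true)) ||
              (x e && (f (update x e false) || f (update x e true)))) = false} :=
        Set.ext fun x => by simp only [Set.mem_setOf_eq, key x]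
      rw [hset1, hset2]
      exact add_le_add (le_of_eq (stub_nullMass n e f)) (stub_plantedMass n k e f)

/-! ### The rung in the crux's format -/

/-- **`MonotoneSuffices` for De Morgan detectors with few negated variables.** Let a detector family be
presented as `{∧₂,∨₂,0,1}`-circuits `D n` on the doubled input (positive copies and negated copies of the
edge variables) of size `≤ s n`, read at the literal vector `ℓ_{T n}(x)` that negates only the variables
in `T n`, with `2^{|T n|} ≤ (s n + n)^c` eventually (e.g. `|T n| ≤ c log₂ n`). If its error sum at
clique size `k n` tends to `0`, then a family of `{∧₂,∨₂,0,1}`-circuits on the edge variables alone, of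
size `≤ (s n + n)^{c+1}` eventually, has error sum `→ 0` (indeed pointwise no larger). This is the
crux's implication for that class of detectors, with `a = c + 1`, at every clique size. [folklore] -/
theorem stub_negatedInputs :
    ∀ (k s : ℕ → ℕ) (c : ℕ) (T : (n : ℕ) → Finset ((⊤ : SimpleGraph (Fin n)).edgeSet))
      (D : (n : ℕ) → Circuit ((⊤ : SimpleGraph (Fin n)).edgeSet ⊕ (⊤ : SimpleGraph (Fin n)).edgeSet))
      (hD : ∀ᶠ n : ℕ in atTop, (D n).IsOver monotoneBasis01 ∧ (D n).size ≤ s n ∧ 2 ^ (T n).card ≤ (s n + n) ^ c)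
      (herr : Tendsto (fun n : ℕ =>
        (erdosRenyiHalf n).toOuterMeasure
            {x | (D n).eval (Sum.elim x (fun i => if i ∈ T n then !(x i) else true)) = true} +
          (plantedCliqueDist n (k n)).toOuterMeasure
            {x | (D n).eval (Sum.elim x (fun i => if i ∈ T n then !(x i) else true)) = false})
        atTop (nhds 0)),
    ∃ M : (n : ℕ) → Circuit ((⊤ : SimpleGraph (Fin n)).edgeSet),
      (∀ᶠ n : ℕ in atTop, (M n).IsOver monotoneBasis01 ∧ (M n).size ≤ (s n + n) ^ (c + 1)) ∧
      Tendsto (fun n : ℕ => (erdosRenyiHalf n).toOuterMeasure {x | (M n).eval x = true} +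
          (plantedCliqueDist n (k n)).toOuterMeasure {x | (M n).eval x = false}) atTop (nhds 0) := by
  intro k s c T D hD herr
  classical
  -- pointwise in `n`: the monotone circuit with its two guarantees (junk where `D n` is not monotone)
  have hex : ∀ n : ℕ, (D n).IsOver monotoneBasis01 →
      ∃ M : Circuit ((⊤ : SimpleGraph (Fin n)).edgeSet), M.IsOver monotoneBasis01 ∧
        M.size ≤ 2 ^ (T n).card * ((D n).size + 8) ∧
        (erdosRenyiHalf n).toOuterMeasure {x | M.eval x = true} +
            (plantedCliqueDist n (k n)).toOuterMeasure {x | M.eval x = false} ≤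
          (erdosRenyiHalf n).toOuterMeasure
              {x | (D n).eval (Sum.elim x (fun i => if i ∈ T n then !(x i) else true)) = true} +
            (plantedCliqueDist n (k n)).toOuterMeasure
              {x | (D n).eval (Sum.elim x (fun i => if i ∈ T n then !(x i) else true)) = false} := by
    intro n hDn
    obtain ⟨G, hG, herrG⟩ := negIn_elim n (k n) (T n) (D n).eval (D n).size ((D n).cktSize_eval hDn)
    obtain ⟨M, hM, hsize, hev⟩ := hG.toCircuit
    refine ⟨M, hM, hsize, ?_⟩
    have h1 : {x | M.eval x = true} = {x | G x = true} := by ext x; simp [hev x]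
    have h2 : {x | M.eval x = false} = {x | G x = false} := by ext x; simp [hev x]
    rw [h1, h2]
    exact herrG
  let M : (n : ℕ) → Circuit ((⊤ : SimpleGraph (Fin n)).edgeSet) := fun n =>
    if h : (D n).IsOver monotoneBasis01 then (hex n h).choose else Circuit.const _ false
  have hMspec : ∀ᶠ n : ℕ in atTop, (M n).IsOver monotoneBasis01 ∧ (M n).size ≤ (s n + n) ^ (c + 1) ∧
      (erdosRenyiHalf n).toOuterMeasure {x | (M n).eval x = true} +
          (plantedCliqueDist n (k n)).toOuterMeasure {x | (M n).eval x = false} ≤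
        (erdosRenyiHalf n).toOuterMeasure
            {x | (D n).eval (Sum.elim x (fun i => if i ∈ T n then !(x i) else true)) = true} +
          (plantedCliqueDist n (k n)).toOuterMeasure
            {x | (D n).eval (Sum.elim x (fun i => if i ∈ T n then !(x i) else true)) = false} := by
    filter_upwards [hD, eventually_ge_atTop 8] with n hn h8
    have hMn : M n = (hex n hn.1).choose := dif_pos hn.1
    obtain ⟨hB, hsize, herrn⟩ := (hex n hn.1).choose_spec
    rw [hMn]
    refine ⟨hB, hsize.trans ?_, herrn⟩
    calc 2 ^ (T n).card * ((D n).size + 8) ≤ (s n + n) ^ c * (s n + n) :=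
          Nat.mul_le_mul hn.2.2 (by omega)
      _ = (s n + n) ^ (c + 1) := (pow_succ _ _).symm
  refine ⟨M, hMspec.mono fun n h => ⟨h.1, h.2.1⟩, ?_⟩
  refine tendsto_of_tendsto_of_tendsto_of_le_of_le' tendsto_const_nhds herr
    (Eventually.of_forall fun _ => bot_le) (hMspec.mono fun n h => h.2.2)

end Summit.PneNP.PneNP.Theorems.MonotoneSuffices.Compression
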